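import Summits.ResolutionOfSingularities.ResolutionOfSingularities.Theorems.FrobeniusLadderFInjectiveMacaulayficationF108ToricCones

/-!
# [OURS · L1 W4.5a · F-108 toric infrastructure 2/7] A star subdivision preserves the elementary invariants and goodness

For a valid face `τ` (at least two rays, carried by some cone, one ray interior) and any scale `N ≥ 2`, the star subdivision
`dstar N S τ` of a state satisfying `Inv S` has: nonnegative rays, coordinate-or-interior rays, the dual basis, `l`-minimality, boundary
vanishing, `m ≥ 0`, `m_l ≥ 1`, COMPLETENESS (explicit re-expansion of a lattice point in the child selected by the minimal coefficient on
`τ`), and every `Good 𝒜` cone stays `Good 𝒜`.  The three inequalities needing a large scale (`sc`, `dom`, `amem`) are file 3/7.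
AI-written; weaker than expert review. Nothing here proves resolution of singularities in positive characteristic.
-/

set_option linter.dupNamespace false

noncomputable section

namespace Summit.ResolutionOfSingularities.ResolutionOfSingularities.Theorems.FInjectiveMacaulayfication.F108Toric

open Matrix Finset

variable {n : ℕ}

/-- A VALID face of a state: at least two rays, carried by some cone, and containing an interior ray (so that its barycentre is
interior — the centre of the blow-up lies over the origin). [OURS · bookkeeping] -/
structure ValidFace (S : Finset (DCone n)) (τ : Finset (Fin n → ℤ)) : Prop where
  /-- at least two rays -/
  two : 2 ≤ τ.card
  /-- carried by a cone of the state -/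
  sub : ∃ d ∈ S, τ ⊆ d.rays
  /-- contains an interior ray -/
  interior : ∃ ρ ∈ τ, ∀ j, 1 ≤ ρ j

/-- Coordinates of the barycentre. -/
theorem bary_apply (τ : Finset (Fin n → ℤ)) (j : Fin n) : bary τ j = ∑ ρ ∈ τ, ρ j := by
  simp [bary, Finset.sum_apply]

section star

variable {S : Finset (DCone n)} (hS : Inv S) {τ : Finset (Fin n → ℤ)}
include hS

/-- Rays of a carried face are nonnegative. -/
theorem Inv.face_nonneg {d : DCone n} (hd : d ∈ S) (hτ : τ ⊆ d.rays) {ρ : Fin n → ℤ} (hρ : ρ ∈ τ) (j : Fin n) : 0 ≤ ρ j := by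
  obtain ⟨i, rfl⟩ := mem_rays.1 (hτ hρ)
  exact hS.nonneg d hd i j

/-- The barycentre of a valid face is interior. -/
theorem Inv.one_le_bary (hτ : ValidFace S τ) (j : Fin n) : 1 ≤ bary τ j := by
  obtain ⟨d, hd, hsub⟩ := hτ.sub
  obtain ⟨ρ, hρ, hpos⟩ := hτ.interior
  rw [bary_apply, ← Finset.add_sum_erase _ _ hρ]
  have : 0 ≤ ∑ x ∈ τ.erase ρ, x j :=
    sum_nonneg fun x hx => hS.face_nonneg hd hsub (mem_of_mem_erase hx) j
  linarith [hpos j]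

/-- The barycentre of a valid face is nonnegative. -/
theorem Inv.bary_nonneg (hτ : ValidFace S τ) (j : Fin n) : 0 ≤ bary τ j := le_trans zero_le_one (hS.one_le_bary hτ j)

/-- Nonnegativity survives a star. -/
theorem Inv.nonneg_dstar (hτ : ValidFace S τ) (N : ℤ) : ∀ d' ∈ dstar N S τ, ∀ i j, 0 ≤ d'.ray i j := by
  intro d' hd' i j
  obtain ⟨d, hd, h⟩ := mem_dstar.1 hd'
  rcases h with ⟨-, i₀, -, rfl⟩ | ⟨-, rfl⟩
  · by_cases hi : i = i₀
    · subst hi; rw [child_ray_self]; exact hS.bary_nonneg hτ j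
    · rw [child_ray_of_ne _ _ _ hi]; exact hS.nonneg d hd i j
  · exact hS.nonneg d hd i j

/-- Coordinate-or-interior survives a star (the new ray is interior). -/
theorem Inv.stdOrPos_dstar (hτ : ValidFace S τ) (N : ℤ) :
    ∀ d' ∈ dstar N S τ, ∀ i, (∃ j, d'.ray i = Pi.single j 1) ∨ ∀ j, 1 ≤ d'.ray i j := by
  intro d' hd' i
  obtain ⟨d, hd, h⟩ := mem_dstar.1 hd'
  rcases h with ⟨-, i₀, -, rfl⟩ | ⟨-, rfl⟩
  · by_cases hi : i = i₀
    · subst hi; rw [child_ray_self]; exact Or.inr (hS.one_le_bary hτ)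
    · rw [child_ray_of_ne _ _ _ hi]; exact hS.stdOrPos d hd i
  · exact hS.stdOrPos d hd i

/-- The dual basis of a child. -/
theorem Inv.dual_child {d : DCone n} (hd : d ∈ S) (hτ : τ ⊆ d.rays) {i₀ : Fin n} (hi₀ : d.ray i₀ ∈ τ) (N : ℤ) (i j : Fin n) :
    (child N τ d i₀).ray j ⬝ᵥ (child N τ d i₀).w i = if i = j then 1 else 0 := by
  rw [child_w]
  by_cases hj : j = i₀
  · rw [hj, child_ray_self]
    by_cases hc : d.ray i ∈ τ ∧ i ≠ i₀
    · rw [if_pos hc, dotProduct_sub, hS.bary_dotProduct_w hd hτ, hS.bary_dotProduct_w hd hτ, if_pos hc.1, if_pos hi₀,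
        if_neg hc.2]; ring
    · rw [if_neg hc, hS.bary_dotProduct_w hd hτ]
      by_cases h2 : i = i₀
      · have hmem : d.ray i ∈ τ := by rw [h2]; exact hi₀
        rw [if_pos hmem, if_pos h2]
      · have hni : d.ray i ∉ τ := fun hmem => hc ⟨hmem, h2⟩
        rw [if_neg hni, if_neg h2]
  · rw [child_ray_of_ne _ _ _ hj]
    by_cases hc : d.ray i ∈ τ ∧ i ≠ i₀
    · have hne : ¬ i₀ = j := fun h => hj h.symm
      rw [if_pos hc, dotProduct_sub, hS.dual d hd, hS.dual d hd, if_neg hne, sub_zero]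
    · rw [if_neg hc, hS.dual d hd]

/-- The dual basis survives a star. -/
theorem Inv.dual_dstar (N : ℤ) :
    ∀ d' ∈ dstar N S τ, ∀ i j, d'.ray j ⬝ᵥ d'.w i = if i = j then 1 else 0 := by
  intro d' hd' i j
  obtain ⟨d, hd, h⟩ := mem_dstar.1 hd'
  rcases h with ⟨hsub, i₀, hi₀, rfl⟩ | ⟨-, rfl⟩
  · exact hS.dual_child hd hsub hi₀ N i j
  · exact hS.dual d hd i j

/-- `l`-minimality survives a star. -/
theorem Inv.lmin_dstar (N : ℤ) : ∀ d' ∈ dstar N S τ, ∀ i j, d'.ray i d'.l ≤ d'.ray i j := by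
  intro d' hd' i j
  obtain ⟨d, hd, h⟩ := mem_dstar.1 hd'
  rcases h with ⟨hsub, i₀, -, rfl⟩ | ⟨-, rfl⟩
  · rw [child_l]
    by_cases hi : i = i₀
    · subst hi
      rw [child_ray_self, bary_apply, bary_apply]
      refine sum_le_sum fun ρ hρ => ?_
      obtain ⟨k, rfl⟩ := mem_rays.1 (hsub hρ)
      exact hS.lmin d hd k j
    · rw [child_ray_of_ne _ _ _ hi]; exact hS.lmin d hd i j
  · exact hS.lmin d hd i j

/-- Boundary vanishing survives a star (the new ray has no zero coordinate; an old boundary ray is not the replaced one). -/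
theorem Inv.bdry_dstar (hτ : ValidFace S τ) (N : ℤ) :
    ∀ d' ∈ dstar N S τ, ∀ i, (∃ j, d'.ray i j = 0) → d'.ray i ⬝ᵥ d'.m = 0 := by
  intro d' hd' i hz
  obtain ⟨d, hd, h⟩ := mem_dstar.1 hd'
  rcases h with ⟨hsub, i₀, hi₀, rfl⟩ | ⟨-, rfl⟩
  · by_cases hi : i = i₀
    · subst hi
      obtain ⟨j, hj⟩ := hz
      rw [child_ray_self] at hj
      have := hS.one_le_bary hτ j
      omega
    · rw [child_ray_of_ne _ _ _ hi] at hz ⊢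
      rw [child_m, dotProduct_add, dotProduct_smul, hS.bdry d hd i hz, hS.dual d hd, if_neg (Ne.symm hi)]
      simp
  · obtain ⟨j, hj⟩ := hz
    simp only [scaleD_ray] at hj ⊢
    rw [scaleD_m, dotProduct_smul, hS.bdry d hd i ⟨j, hj⟩, smul_zero]

/-- In a state, `m + w i ≥ 0` for every cone and slot (neighbour membership read at the coordinate rays). -/
theorem Inv.m_add_w_nonneg {d : DCone n} (hd : d ∈ S) (i j : Fin n) : 0 ≤ d.m j + d.w i j := by
  rcases hS.amem d hd i with h1 | ⟨j', hj'⟩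
  · obtain ⟨d'', hd'', i'', hi''⟩ := hS.exists_ray_eq_single j
    have h := h1 d'' hd'' i''
    rw [hi'', single_dotProduct, one_mul] at h
    simp only [Pi.add_apply, Pi.sub_apply, Pi.single_apply] at h
    have hm := hS.mnonneg d'' hd'' j
    have hl := hS.mlpos d'' hd''
    by_cases ha : d.l = j
    · rw [if_pos ha] at h
      by_cases hb : d''.l = j
      · subst hb; rw [if_pos rfl] at h; omega
      · rw [if_neg hb] at h; omega
    · rw [if_neg ha] at h
      by_cases hb : d''.l = j
      · subst hb; rw [if_pos rfl] at h; omega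
      · rw [if_neg hb] at h; omega
  · rw [hj']
    have hm := hS.mnonneg d hd j
    have hl := hS.mlpos d hd
    simp only [Pi.sub_apply, Pi.single_apply]
    by_cases h2 : j = d.l
    · subst h2
      by_cases h1 : d.l = j'
      · rw [if_pos h1, if_pos rfl]; omega
      · rw [if_neg h1, if_pos rfl]; omega
    · rw [if_neg h2]
      by_cases h1 : j = j'
      · rw [if_pos h1]; omega
      · rw [if_neg h1]; omega

/-- `m ≥ 0` survives a star with scale `N ≥ 1`. -/
theorem Inv.mnonneg_dstar {N : ℤ} (hN : 1 ≤ N) : ∀ d' ∈ dstar N S τ, ∀ j, 0 ≤ d'.m j := by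
  intro d' hd' j
  obtain ⟨d, hd, h⟩ := mem_dstar.1 hd'
  rcases h with ⟨-, i₀, -, rfl⟩ | ⟨-, rfl⟩
  · rw [child_m]
    simp only [Pi.add_apply, Pi.smul_apply, smul_eq_mul]
    have h1 := hS.m_add_w_nonneg hd i₀ j
    have h2 := hS.mnonneg d hd j
    nlinarith
  · simp only [scaleD_m, Pi.smul_apply, smul_eq_mul]
    exact mul_nonneg (by omega) (hS.mnonneg d hd j)

/-- `m_l ≥ 1` survives a star with scale `N ≥ 2`. -/
theorem Inv.mlpos_dstar {N : ℤ} (hN : 2 ≤ N) : ∀ d' ∈ dstar N S τ, 1 ≤ d'.m d'.l := by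
  intro d' hd'
  obtain ⟨d, hd, h⟩ := mem_dstar.1 hd'
  rcases h with ⟨-, i₀, -, rfl⟩ | ⟨-, rfl⟩
  · rw [child_m, child_l]
    simp only [Pi.add_apply, Pi.smul_apply, smul_eq_mul]
    have h1 := hS.m_add_w_nonneg hd i₀ d.l
    have h2 := hS.mlpos d hd
    nlinarith
  · simp only [scaleD_m, scaleD_l, Pi.smul_apply, smul_eq_mul]
    nlinarith [hS.mlpos d hd]

/-- COMPLETENESS survives a star: a lattice point expanded on an affected cone re-expands, with nonnegative integral coefficients, on
the child selected by a slot of `τ` with minimal coefficient. -/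
theorem Inv.complete_dstar (hτ : ValidFace S τ) (N : ℤ) :
    ∀ x : Fin n → ℤ, (∀ j, 0 ≤ x j) → ∃ d' ∈ dstar N S τ, ∃ c : Fin n → ℤ, (∀ i, 0 ≤ c i) ∧ x = ∑ i, c i • d'.ray i := by
  classical
  intro x hx
  obtain ⟨d, hd, c, hc, rfl⟩ := hS.complete x hx
  by_cases hsub : τ ⊆ d.rays
  · -- the slots carrying `τ` and the minimal coefficient among them
    set T : Finset (Fin n) := univ.filter fun i => d.ray i ∈ τ with hT
    have hTne : T.Nonempty := by
      obtain ⟨ρ, hρ, -⟩ := hτ.interior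
      obtain ⟨k, hk⟩ := mem_rays.1 (hsub hρ)
      exact ⟨k, by simp [hT, hk, hρ]⟩
    obtain ⟨i₀, hi₀T, hmin⟩ := exists_min_image T c hTne
    have hi₀ : d.ray i₀ ∈ τ := by simpa [hT] using hi₀T
    refine ⟨child N τ d i₀, mem_dstar.2 ⟨d, hd, Or.inl ⟨hsub, i₀, hi₀, rfl⟩⟩,
      fun k => if k = i₀ then c i₀ else if d.ray k ∈ τ then c k - c i₀ else c k, ?_, ?_⟩
    · intro k
      by_cases h1 : k = i₀
      · simp [h1, hc]
      · by_cases h2 : d.ray k ∈ τ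
        · have := hmin k (by simp [hT, h2]); simp [h1, h2]; omega
        · simp [h1, h2, hc]
    · -- compare the two expansions slot by slot after splitting off `i₀`
      rw [← Finset.add_sum_erase _ _ (mem_univ i₀), ← Finset.add_sum_erase _ _ (mem_univ i₀)]
      simp only [if_true, child_ray_self]
      have hv : bary τ = d.ray i₀ + ∑ k ∈ T.erase i₀, d.ray k := by
        rw [hS.bary_eq_sum hd hsub, ← hT, ← Finset.add_sum_erase _ _ hi₀T]
      have hrest : ∑ k ∈ univ.erase i₀, (if k = i₀ then c i₀ else if d.ray k ∈ τ then c k - c i₀ else c k) • (child N τ d i₀).ray k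
          = ∑ k ∈ univ.erase i₀, c k • d.ray k - ∑ k ∈ T.erase i₀, c i₀ • d.ray k := by
        have hTsub : T.erase i₀ = (univ.erase i₀).filter fun k => d.ray k ∈ τ := by
          ext k; simp [hT, and_comm]
        rw [hTsub, Finset.sum_filter, ← Finset.sum_sub_distrib]
        refine sum_congr rfl fun k hk => ?_
        have hk' : k ≠ i₀ := ne_of_mem_erase hk
        rw [child_ray_of_ne _ _ _ hk', if_neg hk']
        by_cases h2 : d.ray k ∈ τ
        · simp [h2, sub_smul]
        · simp [h2]
      rw [hrest, hv, smul_add, Finset.smul_sum]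
      abel
  · exact ⟨scaleD N d, mem_dstar.2 ⟨d, hd, Or.inr ⟨hsub, rfl⟩⟩, c, hc, rfl⟩

omit hS in
/-- Goodness survives a star: the children of a `Good 𝒜` cone are `Good 𝒜` (the new ray is a sum of rays of the cone). -/
theorem good_child (hS : Inv S) {𝒜 : Finset (Fin n → ℤ)} {d : DCone n} (hd : d ∈ S) (hg : Good 𝒜 d) (hτ : τ ⊆ d.rays)
    (N : ℤ) (i₀ : Fin n) : Good 𝒜 (child N τ d i₀) := by
  obtain ⟨b, hb, hmin⟩ := hg
  refine ⟨b, hb, fun i b' hb' => ?_⟩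
  by_cases hi : i = i₀
  · subst hi
    rw [child_ray_self, hS.bary_eq_sum hd hτ, sum_dotProduct', sum_dotProduct']
    exact sum_le_sum fun k _ => hmin k b' hb'
  · rw [child_ray_of_ne _ _ _ hi]; exact hmin i b' hb'

omit hS in
/-- Goodness of every cone survives a star. -/
theorem good_dstar (hS : Inv S) {𝒜 : Finset (Fin n → ℤ)} (hg : ∀ d ∈ S, Good 𝒜 d) (N : ℤ) :
    ∀ d' ∈ dstar N S τ, Good 𝒜 d' := by
  intro d' hd'
  obtain ⟨d, hd, h⟩ := mem_dstar.1 hd'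
  rcases h with ⟨hsub, i₀, -, rfl⟩ | ⟨-, rfl⟩
  · exact good_child hS hd (hg d hd) hsub N i₀
  · obtain ⟨b, hb, hmin⟩ := hg d hd
    exact ⟨b, hb, fun i b' hb' => hmin i b' hb'⟩

end star

end Summit.ResolutionOfSingularities.ResolutionOfSingularities.Theorems.FInjectiveMacaulayfication.F108Toric

end
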